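import Mathlib
import Summits.MatrixMultiplication.MatrixMultiplication.Theses.OrbitHarmonicsHosts
import Summits.MatrixMultiplication.MatrixMultiplication.Theorems.OrbitHarmonicsHostsAssembly
import Summits.MatrixMultiplication.MatrixMultiplication.Theorems.OrbitHarmonicsHostsHostingRestriction
import Summits.MatrixMultiplication.MatrixMultiplication.Theorems.OrbitHarmonicsHostsAbelianNoGoDefs
import Summits.MatrixMultiplication.MatrixMultiplication.Theorems.OrbitHarmonicsHostsAbelianNoGo
import Literature.Computability.AlgebraicComplexity.MatrixMultiplicationExponent
import Literature.Computability.AlgebraicComplexity.SchoenhageTauBini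
import Literature.Computability.AlgebraicComplexity.TwoByTwoRankLowerBound
import Literature.Computability.AlgebraicComplexity.SmallFormatRank

/-!
# Crux-strategist sketch for `OrbitHarmonicsHosts.EquivariantOrbitHosting` (stmt-MatrixMultiplication-5452)

Typed companions of `STRATEGY-CENSUS.md` (planner-cstrat-stmt-MatrixMultiplication-5452-r1-0,
2026-08-17).  Every candidate piece named in the census is a `def … : Prop` here; the cheap
implications that decide the BC2-redirect conditions (a)/(b)/(c) are PROVED (no `sorry`; the open
statements are `def`s, never asserted — this file registers no line and no stub).
-/

set_option linter.unusedVariables false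
set_option linter.dupNamespace false

namespace Summit.MatrixMultiplication.MatrixMultiplication.Cruxes.EquivariantOrbitHosting.Strategist

open scoped BigOperators
open Literature.Computability.AlgebraicComplexity
open Summit.MatrixMultiplication.MatrixMultiplication.Theses.OrbitHarmonicsHosts
  (EquivariantOrbitHosting FlagHosting BeatAbelianBound UniformObstruction HostingRestriction ReesBound
   closes)
open Summit.MatrixMultiplication.MatrixMultiplication.Theorems
  (hostingRestriction_proof reesBound_proof matMulTensor_eq_single_mul_single_apply)

/-! ## §0 Frame: the crux is at least the summit -/

/-- `crux → summit`: the route's deciding theorem fed with the two landed supports. -/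
theorem summit_of_crux (h : EquivariantOrbitHosting) : _root_.MatrixMultiplication :=
  closes h hostingRestriction_proof reesBound_proof

/-! ## §S Strengthen / Frobenius reformulation: regular-orbit algorithms -/

section Actions

variable {Γ : Type} [Group Γ] {N : ℕ}

/-- The (right) action `X · h = ρ(h⁻¹) X σ(h)` of `Γ` on `M_N(ℂ)` through a pair of
representations — the action under which the route states equivariance of `α` (`ρ = ρP`, `σ = ρQ`),
`β` (`ρQ`, `ρR`) and `γ` (`ρP`, `ρR`). -/
def act (ρ σ : Γ →* GL (Fin N) ℂ) (h : Γ) (X : Matrix (Fin N) (Fin N) ℂ) :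
    Matrix (Fin N) (Fin N) ℂ :=
  (ρ h⁻¹ : Matrix (Fin N) (Fin N) ℂ) * X * (σ h : Matrix (Fin N) (Fin N) ℂ)

end Actions

/-- **REGULAR-ORBIT ALGORITHMS** (the Frobenius-reciprocity shadow of a HOMOGENEOUS equivariant
hosting; census §S, §D-2).  For every `ε > 0`: a finite group `Γ` with `|Γ| ≤ N^(2+ε)`, three
representations on `ℂ^N`, two linear forms `a, b` and one matrix `c` such that the `Γ`-ORBIT of the
rank-one tensor `a ⊗ b ⊗ c` sums to `⟨N,N,N⟩`:
`X · Y = ∑_h a(X·h) b(Y·h) (c·h⁻¹)` for all `X, Y`. -/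
def RegularOrbitAlgorithms : Prop :=
  ∀ ε : ℝ, 0 < ε → ∃ (Γ : Type) (_ : Group Γ) (_ : Fintype Γ) (N : ℕ)
    (ρP ρQ ρR : Γ →* GL (Fin N) ℂ) (a b : Matrix (Fin N) (Fin N) ℂ →ₗ[ℂ] ℂ)
    (c : Matrix (Fin N) (Fin N) ℂ), 2 ≤ N ∧ (Fintype.card Γ : ℝ) ≤ (N : ℝ) ^ (2 + ε) ∧
    ∀ X Y : Matrix (Fin N) (Fin N) ℂ,
      X * Y = ∑ h : Γ, (a (act ρP ρQ h X) * b (act ρQ ρR h Y)) • act ρP ρR h⁻¹ c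

/-- An orbit identity is a rank decomposition of `⟨N,N,N⟩` with `|Γ|` terms. -/
theorem tensorRank_le_of_orbit_identity {Γ : Type} [Group Γ] [Fintype Γ] {N : ℕ}
    (ρP ρQ ρR : Γ →* GL (Fin N) ℂ) (a b : Matrix (Fin N) (Fin N) ℂ →ₗ[ℂ] ℂ)
    (c : Matrix (Fin N) (Fin N) ℂ)
    (h : ∀ X Y : Matrix (Fin N) (Fin N) ℂ,
      X * Y = ∑ h : Γ, (a (act ρP ρQ h X) * b (act ρQ ρR h Y)) • act ρP ρR h⁻¹ c) :
    tensorRank (matMulTensor ℂ N N N) ≤ Fintype.card Γ := by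
  classical
  refine tensorRank_le_card_of_eq_sum
    (fun g (r : Fin N × Fin N) => act ρP ρR g⁻¹ c r.1 r.2)
    (fun g (p : Fin N × Fin N) => a (act ρP ρQ g (Matrix.single p.1 p.2 (1 : ℂ))))
    (fun g (q : Fin N × Fin N) => b (act ρQ ρR g (Matrix.single q.1 q.2 (1 : ℂ)))) ?_
  funext r p q
  rw [matMulTensor_eq_single_mul_single_apply, h]
  simp only [Finset.sum_apply, Matrix.sum_apply, Matrix.smul_apply, smul_eq_mul, triad_apply]
  refine Finset.sum_congr rfl fun g _ => ?_
  ring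

/-- **(c) fails for `RegularOrbitAlgorithms`**: it is at least the summit, by one rank count and
Bini's theorem in rank form (`Blaser2013_thm66_holds.of_tensorRank_le`, tree). -/
theorem summit_of_regularOrbitAlgorithms (hA : RegularOrbitAlgorithms) : _root_.MatrixMultiplication := by
  classical
  show Literature.Computability.AlgebraicComplexity.omega ℂ = 2
  refine le_antisymm ?_ (omega_two_le ℂ)
  refine le_of_forall_pos_le_add fun ε hε => ?_
  obtain ⟨Γ, _instG, _instF, N, ρP, ρQ, ρR, a, b, c, hN, hcard, hid⟩ := hA ε hε
  have hrk := tensorRank_le_of_orbit_identity ρP ρQ ρR a b c hid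
  have hr1 : 1 ≤ Fintype.card Γ := Fintype.card_pos
  have hω : omega ℂ ≤ Real.logb N (Fintype.card Γ) :=
    Blaser2013_thm66_holds.of_tensorRank_le ℂ hN hr1 hrk
  have hN1 : (1 : ℝ) < N := by exact_mod_cast (lt_of_lt_of_le (by norm_num) hN)
  have hrpos : (0 : ℝ) < Fintype.card Γ := by exact_mod_cast hr1
  calc omega ℂ ≤ Real.logb N (Fintype.card Γ) := hω
    _ ≤ Real.logb N ((N : ℝ) ^ (2 + ε)) := Real.logb_le_logb_of_le hN1 hrpos hcard
    _ = 2 + ε := Real.logb_rpow (by linarith) (ne_of_gt hN1)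


/-! ## §0′ The hosting predicate (conjuncts 3–8 of the crux, verbatim) and the exponent ladder -/

/-- The route's hosting predicate: free orbit, `γ` kills `span LF(I(P))`, hosting identity upstairs in
`ℂ[x]`, and the three equivariances — conjuncts 3–8 of `EquivariantOrbitHosting`, copied verbatim so
that `crux_iff` below is `Iff.rfl`. -/
def IsHosting (Γ : Type) [Group Γ] (d N : ℕ) (ρV : Γ →* GL (Fin d) ℂ) (v : Fin d → ℂ)
    (ρP ρQ ρR : Γ →* GL (Fin N) ℂ) (α β : Matrix (Fin N) (Fin N) ℂ →ₗ[ℂ] MvPolynomial (Fin d) ℂ)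
    (γ : MvPolynomial (Fin d) ℂ →ₗ[ℂ] Matrix (Fin N) (Fin N) ℂ) : Prop :=
  Function.Injective (fun g : Γ => (ρV g : Matrix (Fin d) (Fin d) ℂ).mulVec v) ∧ (∀ f ∈ Ideal.span ((fun f : MvPolynomial (Fin d) ℂ => MvPolynomial.homogeneousComponent f.totalDegree f) '' ((MvPolynomial.vanishingIdeal ℂ (Set.range fun g : Γ => (ρV g : Matrix (Fin d) (Fin d) ℂ).mulVec v) : Ideal (MvPolynomial (Fin d) ℂ)) : Set (MvPolynomial (Fin d) ℂ))), γ f = 0) ∧ (∀ X Y, γ (α X * β Y) = X * Y) ∧ (∀ (g : Γ) (X : Matrix (Fin N) (Fin N) ℂ), α ((ρP g⁻¹ : Matrix (Fin N) (Fin N) ℂ) * X * (ρQ g : Matrix (Fin N) (Fin N) ℂ)) = MvPolynomial.aeval (fun i : Fin d => ∑ j : Fin d, (ρV g : Matrix (Fin d) (Fin d) ℂ) i j • (MvPolynomial.X j : MvPolynomial (Fin d) ℂ)) (α X)) ∧ (∀ (g : Γ) (Y : Matrix (Fin N) (Fin N) ℂ), β ((ρQ g⁻¹ : Matrix (Fin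 N) (Fin N) ℂ) * Y * (ρR g : Matrix (Fin N) (Fin N) ℂ)) = MvPolynomial.aeval (fun i : Fin d => ∑ j : Fin d, (ρV g : Matrix (Fin d) (Fin d) ℂ) i j • (MvPolynomial.X j : MvPolynomial (Fin d) ℂ)) (β Y)) ∧ (∀ (g : Γ) (f : MvPolynomial (Fin d) ℂ), γ (MvPolynomial.aeval (fun i : Fin d => ∑ j : Fin d, (ρV g : Matrix (Fin d) (Fin d) ℂ) i j • (MvPolynomial.X j : MvPolynomial (Fin d) ℂ)) (f)) = (ρP g⁻¹ : Matrix (Fin N) (Fin N) ℂ) * γ f * (ρR g : Matrix (Fin N) (Fin N) ℂ))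

/-- **Hosting at exponent `τ`**: some instance with `2 ≤ N` and `|Γ| ≤ N^τ`. -/
def HostingExponent (τ : ℝ) : Prop :=
  ∃ (Γ : Type) (_ : Group Γ) (_ : Fintype Γ) (d N : ℕ) (ρV : Γ →* GL (Fin d) ℂ) (v : Fin d → ℂ)
    (ρP ρQ ρR : Γ →* GL (Fin N) ℂ) (α β : Matrix (Fin N) (Fin N) ℂ →ₗ[ℂ] MvPolynomial (Fin d) ℂ)
    (γ : MvPolynomial (Fin d) ℂ →ₗ[ℂ] Matrix (Fin N) (Fin N) ℂ),
    2 ≤ N ∧ (Fintype.card Γ : ℝ) ≤ (N : ℝ) ^ τ ∧ IsHosting Γ d N ρV v ρP ρQ ρR α β γ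

/-- The crux is literally "hosting at every exponent `2 + ε`". -/
theorem crux_iff : EquivariantOrbitHosting ↔ ∀ ε : ℝ, 0 < ε → HostingExponent (2 + ε) := Iff.rfl

/-! ## §D-4 The `ε`-split: base instance ∧ amplification -/

/-- **CUBIC INSTANCE** (TRUE, not landed: `ℤ/N³ ↷ ℂ`, `P = μ_{N³}`, `gr = ℂ[x]/(x^{N³})` hosts
`⟨N,N,N⟩` equivariantly with `|Γ| = N³` — refuter note (3) on item 5456; it is also the equality
case of the PROVED `AbelianNoGo`).  Typed so that the amplification seam below is checkable. -/
def CubicInstance : Prop := HostingExponent 3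

/-- **AMPLIFICATION** (census §D-4): hosting exponents are downward closed above `2`.  No mechanism
is known (Kronecker products of hostings realise only the weighted mean of the two exponents), and
the seam below shows it is `≥` the crux given the true `CubicInstance` — (c) fails. -/
def Amplification : Prop :=
  ∀ τ : ℝ, HostingExponent τ → ∀ τ' : ℝ, 2 < τ' → τ' < τ → HostingExponent τ'

/-- The `ε`-split seam: `Amplification ∧ CubicInstance → crux` (five lines of logic — a trivial seam,
(b) fails; and since `CubicInstance` is true, `Amplification` alone carries the crux, (c) fails). -/
theorem crux_of_amplification (hA : Amplification) (h3 : CubicInstance) : EquivariantOrbitHosting := by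
  rw [crux_iff]
  intro ε hε
  by_cases hε1 : ε < 1
  · exact hA 3 h3 (2 + ε) (by linarith) (by linarith)
  · obtain ⟨Γ, iG, iF, d, N, ρV, v, ρP, ρQ, ρR, α, β, γ, hN, hcard, hH⟩ := h3
    refine ⟨Γ, iG, iF, d, N, ρV, v, ρP, ρQ, ρR, α, β, γ, hN, hcard.trans ?_, hH⟩
    have hN1 : (1 : ℝ) ≤ N := by exact_mod_cast (le_trans (by norm_num) hN)
    exact Real.rpow_le_rpow_of_exponent_le hN1 (by linarith)

/-! ## §D-5 / §N The negation side: `¬ UniformObstruction` is a costume of the crux -/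

/-- `¬ UniformObstruction → crux`: the route's refuter-facing crux, negated, already contains the
crux (take `c = ε`, `C = 1`; `2 ≤ N` is forced by `|Γ| ≥ 1`).  So a split using
`¬ UniformObstruction` as a piece cuts nothing ((c) fails). -/
theorem crux_of_not_uniformObstruction (h : ¬ UniformObstruction) : EquivariantOrbitHosting := by
  rw [crux_iff]
  intro ε hε
  by_contra hne
  apply h
  refine ⟨ε, hε, 1, ?_⟩
  intro Γ _ _ d N ρV v ρP ρQ ρR α β γ hinj hkill hhost hα hβ hγ
  by_contra hlt
  apply hne
  have hcard1 : (1 : ℝ) ≤ Fintype.card Γ := by exact_mod_cast Fintype.card_pos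
  have hlt' : (Fintype.card Γ : ℝ) < (N : ℝ) ^ (2 + ε) := by
    rw [one_mul] at hlt; exact lt_of_not_ge hlt
  refine ⟨Γ, inferInstance, inferInstance, d, N, ρV, v, ρP, ρQ, ρR, α, β, γ, ?_, hlt'.le,
    hinj, hkill, hhost, hα, hβ, hγ⟩
  by_contra hN
  push Not at hN
  interval_cases N
  · have : (0 : ℝ) ^ (2 + ε) = 0 := Real.zero_rpow (by linarith)
    simp only [CharP.cast_eq_zero, this] at hlt'
    linarith
  · simp only [Nat.cast_one, Real.one_rpow] at hlt'
    linarith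


/-! ## §S Strengthen: HOMOGENEOUS hostings are EXACT-rank objects (kernel-checked)

The structural fact behind the "Strengthen" entry of the census: if `α` and `β` take values in
homogeneous polynomials of fixed degrees `k` and `ℓ`, then the hosting identity factors through
evaluation on the point set and is a RANK decomposition of `⟨N,N,N⟩` with one term per point —
equivariance and freeness play no role.  So every hosting with `|Γ| < R(⟨N,N,N⟩)` is
INHOMOGENEOUS; all border-rank savings of the orbit-harmonics host live in the mixing of degrees.
-/

/-- Evaluation of polynomials on an indexed family of points, as a linear map to functions. -/
noncomputable def evL {Γ : Type} {d : ℕ} (F : Γ → (Fin d → ℂ)) :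
    MvPolynomial (Fin d) ℂ →ₗ[ℂ] (Γ → ℂ) :=
  LinearMap.pi fun g => (MvPolynomial.aeval (F g) : MvPolynomial (Fin d) ℂ →ₐ[ℂ] ℂ).toLinearMap

@[simp] theorem evL_apply {Γ : Type} {d : ℕ} (F : Γ → (Fin d → ℂ)) (f : MvPolynomial (Fin d) ℂ)
    (g : Γ) : evL F f g = MvPolynomial.aeval (F g) f := rfl

theorem evL_mul {Γ : Type} {d : ℕ} (F : Γ → (Fin d → ℂ)) (f h : MvPolynomial (Fin d) ℂ) :
    evL F (f * h) = evL F f * evL F h := by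
  funext g
  simp

/-- **Homogeneous hosting is exact** (census §S, Lean-checked): a bi-homogeneous hosting
`γ (α X · β Y) = X · Y` with `γ` killing the leading-form ideal of the point family `F : Γ → ℂ^d`
gives `R(⟨N,N,N⟩) ≤ |Γ|`.  Proof: on homogeneous polynomials of degree `k + ℓ`, "vanishes on the
points" implies "is its own leading form", so `γ` factors through evaluation, `γ|_V = L ∘ ev`; then
`X·Y = L(ev(αX) · ev(βY)) = ∑_g ev(αX)(g) ev(βY)(g) L(δ_g)`. -/
theorem tensorRank_le_of_homogeneous_hosting {Γ : Type} [Fintype Γ] {d N : ℕ}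
    (F : Γ → (Fin d → ℂ)) (α β : Matrix (Fin N) (Fin N) ℂ →ₗ[ℂ] MvPolynomial (Fin d) ℂ)
    (γ : MvPolynomial (Fin d) ℂ →ₗ[ℂ] Matrix (Fin N) (Fin N) ℂ) (k ℓ : ℕ)
    (hkill : ∀ f ∈ Ideal.span ((fun f : MvPolynomial (Fin d) ℂ =>
        MvPolynomial.homogeneousComponent f.totalDegree f) ''
        ((MvPolynomial.vanishingIdeal ℂ (Set.range F) : Ideal (MvPolynomial (Fin d) ℂ)) :
          Set (MvPolynomial (Fin d) ℂ))), γ f = 0)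
    (hhost : ∀ X Y, γ (α X * β Y) = X * Y)
    (hα : ∀ X, (α X).IsHomogeneous k) (hβ : ∀ Y, (β Y).IsHomogeneous ℓ) :
    tensorRank (matMulTensor ℂ N N N) ≤ Fintype.card Γ := by
  classical
  set V : Submodule ℂ (MvPolynomial (Fin d) ℂ) := MvPolynomial.homogeneousSubmodule (Fin d) ℂ (k + ℓ)
    with hV
  set evV : V →ₗ[ℂ] (Γ → ℂ) := (evL F).comp V.subtype with hevV
  set γV : V →ₗ[ℂ] Matrix (Fin N) (Fin N) ℂ := γ.comp V.subtype with hγV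
  -- (1) a homogeneous polynomial vanishing on the points is its own leading form, so `γ` kills it
  have hker : LinearMap.ker evV ≤ LinearMap.ker γV := by
    intro f hf
    rw [LinearMap.mem_ker] at hf ⊢
    have hfV : (f : MvPolynomial (Fin d) ℂ).IsHomogeneous (k + ℓ) :=
      (MvPolynomial.mem_homogeneousSubmodule _ _).mp f.2
    have hvan : (f : MvPolynomial (Fin d) ℂ) ∈ MvPolynomial.vanishingIdeal ℂ (Set.range F) := by
      rw [MvPolynomial.mem_vanishingIdeal_iff]
      rintro x ⟨g, rfl⟩
      exact congrFun hf g
    show γ f = 0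
    by_cases hf0 : (f : MvPolynomial (Fin d) ℂ) = 0
    · rw [hf0, map_zero]
    apply hkill
    apply Ideal.subset_span
    refine ⟨f, hvan, ?_⟩
    show MvPolynomial.homogeneousComponent (f : MvPolynomial (Fin d) ℂ).totalDegree
      (f : MvPolynomial (Fin d) ℂ) = f
    rw [hfV.totalDegree hf0]
    exact MvPolynomial.homogeneousComponent_eq_self hfV
  -- (2) so `γ` restricted to `V` factors through evaluation on the points
  set L₀ : LinearMap.range evV →ₗ[ℂ] Matrix (Fin N) (Fin N) ℂ :=
    ((LinearMap.ker evV).liftQ γV hker).comp evV.quotKerEquivRange.symm.toLinearMap with hL₀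
  obtain ⟨L, hL⟩ := LinearMap.exists_extend L₀
  have hfac : ∀ f : V, L (evV f) = γ f := by
    intro f
    have h1 : L (evV f) = L₀ ⟨evV f, LinearMap.mem_range_self evV f⟩ := by
      rw [← hL]; rfl
    rw [h1, hL₀, LinearMap.comp_apply]
    change (LinearMap.ker evV).liftQ γV hker
      (evV.quotKerEquivRange.symm ⟨evV f, LinearMap.mem_range_self evV f⟩) = γ f
    rw [LinearMap.quotKerEquivRange_symm_apply_image evV f (LinearMap.mem_range_self evV f)]
    rfl
  -- (3) the rank decomposition, one term per point
  refine tensorRank_le_card_of_eq_sum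
    (fun g (r : Fin N × Fin N) => L (Pi.single g 1) r.1 r.2)
    (fun g (p : Fin N × Fin N) => MvPolynomial.aeval (F g) (α (Matrix.single p.1 p.2 (1 : ℂ))))
    (fun g (q : Fin N × Fin N) => MvPolynomial.aeval (F g) (β (Matrix.single q.1 q.2 (1 : ℂ)))) ?_
  funext r p q
  have key : ∀ X Y : Matrix (Fin N) (Fin N) ℂ, X * Y =
      ∑ g, (MvPolynomial.aeval (F g) (α X) * MvPolynomial.aeval (F g) (β Y)) •
        L (Pi.single g (1 : ℂ)) := by
    intro X Y
    have hmem : α X * β Y ∈ V :=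
      (MvPolynomial.mem_homogeneousSubmodule _ _).mpr ((hα X).mul (hβ Y))
    have h1 : X * Y = L (evL F (α X * β Y)) := by
      rw [← hhost X Y, ← hfac ⟨α X * β Y, hmem⟩]
      rfl
    have h2 : evL F (α X * β Y) =
        ∑ g, (MvPolynomial.aeval (F g) (α X) * MvPolynomial.aeval (F g) (β Y)) •
          (Pi.single g (1 : ℂ) : Γ → ℂ) := by
      funext g'
      simp [Finset.sum_apply, Pi.single_apply]
    rw [h1, h2, map_sum]
    simp only [map_smul]
  rw [matMulTensor_eq_single_mul_single_apply, key]
  simp only [Finset.sum_apply, Matrix.sum_apply, Matrix.smul_apply, smul_eq_mul, triad_apply]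
  refine Finset.sum_congr rfl fun g _ => ?_
  ring

/-- **S⁺ = HOMOGENEOUS ORBIT HOSTING** (census §S): the crux with `α`, `β` homogeneous of some
degrees `k`, `ℓ` (by equivariance and semisimplicity every hosting splits into bi-homogeneous
COMPONENTS, but only a single surviving component is again a hosting — this is the rigid subclass). -/
def HomogeneousOrbitHosting : Prop :=
  ∀ ε : ℝ, 0 < ε → ∃ (Γ : Type) (_ : Group Γ) (_ : Fintype Γ) (d N : ℕ) (ρV : Γ →* GL (Fin d) ℂ)
    (v : Fin d → ℂ) (ρP ρQ ρR : Γ →* GL (Fin N) ℂ)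
    (α β : Matrix (Fin N) (Fin N) ℂ →ₗ[ℂ] MvPolynomial (Fin d) ℂ)
    (γ : MvPolynomial (Fin d) ℂ →ₗ[ℂ] Matrix (Fin N) (Fin N) ℂ) (k ℓ : ℕ),
    2 ≤ N ∧ (Fintype.card Γ : ℝ) ≤ (N : ℝ) ^ (2 + ε) ∧ IsHosting Γ d N ρV v ρP ρQ ρR α β γ ∧
    (∀ X, (α X).IsHomogeneous k) ∧ (∀ Y, (β Y).IsHomogeneous ℓ)

/-- `S⁺ → crux` (drop the homogeneity clauses). -/
theorem crux_of_homogeneous (h : HomogeneousOrbitHosting) : EquivariantOrbitHosting := by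
  rw [crux_iff]
  intro ε hε
  obtain ⟨Γ, iG, iF, d, N, ρV, v, ρP, ρQ, ρR, α, β, γ, k, ℓ, hN, hcard, hH, -, -⟩ := h ε hε
  exact ⟨Γ, iG, iF, d, N, ρV, v, ρP, ρQ, ρR, α, β, γ, hN, hcard, hH⟩

/-- `S⁺ → R(⟨N,N,N⟩) ≤ N^(2+ε)`-type rank bounds `→ summit`, WITHOUT the route's `ReesBound` /
border rank: the added rigidity turns the degeneration into an exact algorithm (census §S: the
strengthening exposes symmetric rank decompositions — Grochow–Moore / Burichenko territory — and is
one rank count away from the summit, so it is no easier). -/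
theorem summit_of_homogeneous (h : HomogeneousOrbitHosting) : _root_.MatrixMultiplication := by
  classical
  show Literature.Computability.AlgebraicComplexity.omega ℂ = 2
  refine le_antisymm ?_ (omega_two_le ℂ)
  refine le_of_forall_pos_le_add fun ε hε => ?_
  obtain ⟨Γ, iG, iF, d, N, ρV, v, ρP, ρQ, ρR, α, β, γ, k, ℓ, hN, hcard, hH, hα, hβ⟩ := h ε hε
  obtain ⟨-, hkill, hhost, -, -, -⟩ := hH
  have hrk := tensorRank_le_of_homogeneous_hosting
    (fun g : Γ => (ρV g : Matrix (Fin d) (Fin d) ℂ).mulVec v) α β γ k ℓ hkill hhost hα hβ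
  have hr1 : 1 ≤ Fintype.card Γ := Fintype.card_pos
  have hω : omega ℂ ≤ Real.logb N (Fintype.card Γ) :=
    Blaser2013_thm66_holds.of_tensorRank_le ℂ hN hr1 hrk
  have hN1 : (1 : ℝ) < N := by exact_mod_cast (lt_of_lt_of_le (by norm_num) hN)
  have hrpos : (0 : ℝ) < Fintype.card Γ := by exact_mod_cast hr1
  calc omega ℂ ≤ Real.logb N (Fintype.card Γ) := hω
    _ ≤ Real.logb N ((N : ℝ) ^ (2 + ε)) := Real.logb_le_logb_of_le hN1 hrpos hcard
    _ = 2 + ε := Real.logb_rpow (by linarith) (ne_of_gt hN1)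

/-- Corollary for the finite search (`BeatAbelianBound`, rank-3 crux): a HOMOGENEOUS instance beating
the abelian bound is an exact algorithm of rank `< N³` — so at `N = 3` it needs `|Γ| ≥ R(⟨3,3,3⟩) ≥ 19`
(Bläser 2003), not `≥ bR ≥ 17`; and at `N = 2` it cannot exist below `|Γ| = 7 = R(⟨2,2,2⟩)`. -/
theorem tensorRank_lt_of_homogeneous_beat {Γ : Type} [Group Γ] [Fintype Γ] {d N : ℕ}
    (ρV : Γ →* GL (Fin d) ℂ) (v : Fin d → ℂ) (ρP ρQ ρR : Γ →* GL (Fin N) ℂ)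
    (α β : Matrix (Fin N) (Fin N) ℂ →ₗ[ℂ] MvPolynomial (Fin d) ℂ)
    (γ : MvPolynomial (Fin d) ℂ →ₗ[ℂ] Matrix (Fin N) (Fin N) ℂ) (k ℓ : ℕ)
    (hH : IsHosting Γ d N ρV v ρP ρQ ρR α β γ) (hα : ∀ X, (α X).IsHomogeneous k)
    (hβ : ∀ Y, (β Y).IsHomogeneous ℓ) (hbeat : Fintype.card Γ < N ^ 3) :
    tensorRank (matMulTensor ℂ N N N) < N ^ 3 := by
  obtain ⟨-, hkill, hhost, -, -, -⟩ := hH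
  exact (tensorRank_le_of_homogeneous_hosting _ α β γ k ℓ hkill hhost hα hβ).trans_lt hbeat


/-- `N = 2`: a homogeneous hosting of `⟨2,2,2⟩` needs at least `7 = R(⟨2,2,2⟩)` points (tree theorem
`seven_le_tensorRank_matMulTensor_two`), so the window `|Γ| ∈ [4,7]` of the finite search is EMPTY for
the homogeneous ansatz except `|Γ| = 7 = ℤ/7` (abelian, excluded by `AbelianNoGo`). -/
theorem seven_le_card_of_homogeneous_hosting_two {Γ : Type} [Group Γ] [Fintype Γ] {d : ℕ}
    (ρV : Γ →* GL (Fin d) ℂ) (v : Fin d → ℂ) (ρP ρQ ρR : Γ →* GL (Fin 2) ℂ)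
    (α β : Matrix (Fin 2) (Fin 2) ℂ →ₗ[ℂ] MvPolynomial (Fin d) ℂ)
    (γ : MvPolynomial (Fin d) ℂ →ₗ[ℂ] Matrix (Fin 2) (Fin 2) ℂ) (k ℓ : ℕ)
    (hH : IsHosting Γ d 2 ρV v ρP ρQ ρR α β γ) (hα : ∀ X, (α X).IsHomogeneous k)
    (hβ : ∀ Y, (β Y).IsHomogeneous ℓ) : 7 ≤ Fintype.card Γ := by
  obtain ⟨-, hkill, hhost, -, -, -⟩ := hH
  exact (seven_le_tensorRank_matMulTensor_two ℂ).trans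
    (tensorRank_le_of_homogeneous_hosting _ α β γ k ℓ hkill hhost hα hβ)

/-- `N = 3`: under Bläser's `R(⟨3,3,3⟩) ≥ 19` (named fact `blaser2003_cor9`) a homogeneous hosting of
`⟨3,3,3⟩` needs `|Γ| ≥ 19`; the finite-search window for the homogeneous ansatz is `|Γ| ∈ [19,26]`,
not `[17,26]`. -/
theorem nineteen_le_card_of_homogeneous_hosting_three (h19 : blaser2003_cor9) {Γ : Type} [Group Γ]
    [Fintype Γ] {d : ℕ} (ρV : Γ →* GL (Fin d) ℂ) (v : Fin d → ℂ) (ρP ρQ ρR : Γ →* GL (Fin 3) ℂ)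
    (α β : Matrix (Fin 3) (Fin 3) ℂ →ₗ[ℂ] MvPolynomial (Fin d) ℂ)
    (γ : MvPolynomial (Fin d) ℂ →ₗ[ℂ] Matrix (Fin 3) (Fin 3) ℂ) (k ℓ : ℕ)
    (hH : IsHosting Γ d 3 ρV v ρP ρQ ρR α β γ) (hα : ∀ X, (α X).IsHomogeneous k)
    (hβ : ∀ Y, (β Y).IsHomogeneous ℓ) : 19 ≤ Fintype.card Γ := by
  obtain ⟨-, hkill, hhost, -, -, -⟩ := hH
  exact (h19 ℂ).trans (tensorRank_le_of_homogeneous_hosting _ α β γ k ℓ hkill hhost hα hβ)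

/-! ## §D-2 The Frobenius cut: (regular-orbit algorithms) ∧ (descent to an orbit-harmonics grading) -/

/-- **FILTERED ORBIT ALGORITHMS** (census §S/§D-2): a regular-orbit algorithm `(Γ, ρ•, a, b, c)`
together with a free orbit `Γ·v ⊂ ℂ^d` and degrees `k, ℓ` such that the coefficient functions
`h ↦ a(X·h)`, `h ↦ b(Y·h)` are restrictions of polynomials of degree `≤ k`, `≤ ℓ`, and the output
vector `c` is orthogonal to all polynomial functions of degree `< k + ℓ` on the orbit.  By Frobenius
reciprocity + Maschke this is EQUIVALENT to `HomogeneousOrbitHosting` (census §S gives both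
directions on paper; only the projections are checked here). -/
def FilteredOrbitAlgorithms : Prop :=
  ∀ ε : ℝ, 0 < ε → ∃ (Γ : Type) (_ : Group Γ) (_ : Fintype Γ) (N : ℕ)
    (ρP ρQ ρR : Γ →* GL (Fin N) ℂ) (a b : Matrix (Fin N) (Fin N) ℂ →ₗ[ℂ] ℂ)
    (c : Matrix (Fin N) (Fin N) ℂ) (d : ℕ) (ρV : Γ →* GL (Fin d) ℂ) (v : Fin d → ℂ) (k ℓ : ℕ),
    2 ≤ N ∧ (Fintype.card Γ : ℝ) ≤ (N : ℝ) ^ (2 + ε) ∧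
    (∀ X Y : Matrix (Fin N) (Fin N) ℂ,
      X * Y = ∑ h : Γ, (a (act ρP ρQ h X) * b (act ρQ ρR h Y)) • act ρP ρR h⁻¹ c) ∧
    Function.Injective (fun g : Γ => (ρV g : Matrix (Fin d) (Fin d) ℂ).mulVec v) ∧
    (∀ X, ∃ p : MvPolynomial (Fin d) ℂ, p.totalDegree ≤ k ∧
      ∀ h : Γ, MvPolynomial.aeval ((ρV h : Matrix (Fin d) (Fin d) ℂ).mulVec v) p = a (act ρP ρQ h X)) ∧
    (∀ Y, ∃ q : MvPolynomial (Fin d) ℂ, q.totalDegree ≤ ℓ ∧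
      ∀ h : Γ, MvPolynomial.aeval ((ρV h : Matrix (Fin d) (Fin d) ℂ).mulVec v) q = b (act ρQ ρR h Y)) ∧
    (∀ f : MvPolynomial (Fin d) ℂ, f.totalDegree < k + ℓ →
      ∑ h : Γ, MvPolynomial.aeval ((ρV h : Matrix (Fin d) (Fin d) ℂ).mulVec v) f • act ρP ρR h⁻¹ c = 0)

/-- Forget the filtration: `FilteredOrbitAlgorithms → RegularOrbitAlgorithms` (so the filtered
form is also `≥` the summit: (c) fails for it as a piece). -/
theorem regularOrbitAlgorithms_of_filtered (h : FilteredOrbitAlgorithms) : RegularOrbitAlgorithms := by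
  intro ε hε
  obtain ⟨Γ, iG, iF, N, ρP, ρQ, ρR, a, b, c, d, ρV, v, k, ℓ, hN, hcard, hid, -, -, -, -⟩ := h ε hε
  exact ⟨Γ, iG, iF, N, ρP, ρQ, ρR, a, b, c, hN, hcard, hid⟩

/-- **ORBIT DESCENT** (census §D-2, the universal piece of the Frobenius cut): EVERY regular-orbit
algorithm descends to some orbit-harmonics grading (a free orbit and degrees making it filtered).
Plausibly false as stated (nothing forces a given orbit algorithm to admit an orbit `Γ·v` whose
low-degree polynomial functions carry `a`, `b` and are orthogonal to `c`), and in any case not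
load-bearing: the existence piece it would be paired with is already `≥` the summit. -/
def OrbitDescent : Prop :=
  ∀ (Γ : Type) [Group Γ] [Fintype Γ] (N : ℕ) (ρP ρQ ρR : Γ →* GL (Fin N) ℂ)
    (a b : Matrix (Fin N) (Fin N) ℂ →ₗ[ℂ] ℂ) (c : Matrix (Fin N) (Fin N) ℂ),
    (∀ X Y : Matrix (Fin N) (Fin N) ℂ,
      X * Y = ∑ h : Γ, (a (act ρP ρQ h X) * b (act ρQ ρR h Y)) • act ρP ρR h⁻¹ c) →
    ∃ (d : ℕ) (ρV : Γ →* GL (Fin d) ℂ) (v : Fin d → ℂ) (k ℓ : ℕ),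
      Function.Injective (fun g : Γ => (ρV g : Matrix (Fin d) (Fin d) ℂ).mulVec v) ∧
      (∀ X, ∃ p : MvPolynomial (Fin d) ℂ, p.totalDegree ≤ k ∧
        ∀ h : Γ, MvPolynomial.aeval ((ρV h : Matrix (Fin d) (Fin d) ℂ).mulVec v) p = a (act ρP ρQ h X)) ∧
      (∀ Y, ∃ q : MvPolynomial (Fin d) ℂ, q.totalDegree ≤ ℓ ∧
        ∀ h : Γ, MvPolynomial.aeval ((ρV h : Matrix (Fin d) (Fin d) ℂ).mulVec v) q = b (act ρQ ρR h Y)) ∧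
      (∀ f : MvPolynomial (Fin d) ℂ, f.totalDegree < k + ℓ →
        ∑ h : Γ, MvPolynomial.aeval ((ρV h : Matrix (Fin d) (Fin d) ℂ).mulVec v) f • act ρP ρR h⁻¹ c = 0)

/-- The Frobenius-cut seam `RegularOrbitAlgorithms ∧ OrbitDescent → FilteredOrbitAlgorithms` is four
lines of logic ((b) fails), and its existence piece is `≥` the summit ((c) fails,
`summit_of_regularOrbitAlgorithms`). -/
theorem filtered_of_algorithms_of_descent (hA : RegularOrbitAlgorithms) (hD : OrbitDescent) :
    FilteredOrbitAlgorithms := by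
  intro ε hε
  obtain ⟨Γ, iG, iF, N, ρP, ρQ, ρR, a, b, c, hN, hcard, hid⟩ := hA ε hε
  obtain ⟨d, ρV, v, k, ℓ, hinj, ha, hb, hc⟩ := hD Γ N ρP ρQ ρR a b c hid
  exact ⟨Γ, iG, iF, N, ρP, ρQ, ρR, a, b, c, d, ρV, v, k, ℓ, hN, hcard, hid, hinj, ha, hb, hc⟩

/-- **FROBENIUS DICTIONARY** (census §S, typed claim, provable-now, M-sized; NOT asserted):
homogeneous equivariant hostings and filtered regular-orbit algorithms are the same objects
(`→`: Maschke lifts of `α`, `β`, `γ` through `F_k ↠ gr_k` and `a = ev_v ∘ α`, `c = γ̃(δ_1)`;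
`←`: `α X := (p_X)_k`, `β Y := (q_Y)_ℓ`, `γ f := ∑_h f_{k+ℓ}(h·v) c·h⁻¹`, orthogonality kills the
lower-order terms and the leading-form ideal). -/
def FrobeniusDictionary : Prop := HomogeneousOrbitHosting ↔ FilteredOrbitAlgorithms

/-! ## §D-3 The coinvariant cut: (explicit-ideal flag hosting) ∧ (orbit harmonics of a regular `S_m`-orbit) -/

/-- The ideal `(e_1, …, e_m)` of elementary symmetric polynomials (so `ℂ[x]/(e_1..e_m) = H^*(Fl_m)`,
the coinvariant algebra of `S_m`). -/
noncomputable def esymmIdeal (m : ℕ) : Ideal (MvPolynomial (Fin m) ℂ) :=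
  Ideal.span (Set.range fun i : Fin m => MvPolynomial.esymm (Fin m) ℂ ((i : ℕ) + 1))

/-- The leading-form ideal of the regular `S_m`-orbit of `(0, 1, …, m-1)` (the ideal written inline
in `FlagHosting`). -/
noncomputable def flagGrIdeal (m : ℕ) : Ideal (MvPolynomial (Fin m) ℂ) :=
  Ideal.span ((fun f : MvPolynomial (Fin m) ℂ => MvPolynomial.homogeneousComponent f.totalDegree f) ''
    ((MvPolynomial.vanishingIdeal ℂ (Set.range fun σ : Equiv.Perm (Fin m) => fun i : Fin m =>
      ((σ i : ℕ) : ℂ)) : Ideal (MvPolynomial (Fin m) ℂ)) : Set (MvPolynomial (Fin m) ℂ)))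

/-- **FLAG ORBIT HARMONICS = COINVARIANTS** (census §D-3, structure piece; a KNOWN theorem —
Steinberg 1964 / Kostant 1963 / Garsia–Procesi 1992 §1: for a regular point the orbit-harmonics
ideal of a reflection group orbit is generated by the positive-degree invariants; support-grade,
L-sized in Lean: needs `dim ℂ[x]/(e_1..e_m) = m!`). -/
def FlagGrIsCoinvariant : Prop := ∀ m : ℕ, flagGrIdeal m = esymmIdeal m

/-- **COINVARIANT HOSTING** (census §D-3, existence piece): `FlagHosting` with the inline
orbit-harmonics ideal replaced by the explicit `(e_1, …, e_m)`.  Its non-equivariant core is again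
`⟺ ω = 2` (Artin monomial box + Behrend, as recorded in the route header), so it is summit-plus-
structure exactly like the crux: (c) fails by the same reading that binned the crux. -/
def CoinvariantHosting : Prop :=
  ∀ ε : ℝ, 0 < ε → ∃ (m N : ℕ) (ρP ρQ ρR : Equiv.Perm (Fin m) →* GL (Fin N) ℂ)
    (α β : Matrix (Fin N) (Fin N) ℂ →ₗ[ℂ] MvPolynomial (Fin m) ℂ)
    (γ : MvPolynomial (Fin m) ℂ →ₗ[ℂ] Matrix (Fin N) (Fin N) ℂ),
    2 ≤ N ∧ (m.factorial : ℝ) ≤ (N : ℝ) ^ (2 + ε) ∧ (∀ f ∈ esymmIdeal m, γ f = 0) ∧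
    (∀ X Y, γ (α X * β Y) = X * Y) ∧
    (∀ (σ : Equiv.Perm (Fin m)) (X : Matrix (Fin N) (Fin N) ℂ),
      α ((ρP σ : Matrix (Fin N) (Fin N) ℂ) * X * (ρQ σ⁻¹ : Matrix (Fin N) (Fin N) ℂ)) =
        MvPolynomial.rename σ (α X)) ∧
    (∀ (σ : Equiv.Perm (Fin m)) (Y : Matrix (Fin N) (Fin N) ℂ),
      β ((ρQ σ : Matrix (Fin N) (Fin N) ℂ) * Y * (ρR σ⁻¹ : Matrix (Fin N) (Fin N) ℂ)) =
        MvPolynomial.rename σ (β Y)) ∧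
    (∀ (σ : Equiv.Perm (Fin m)) (f : MvPolynomial (Fin m) ℂ),
      γ (MvPolynomial.rename σ f) =
        (ρP σ : Matrix (Fin N) (Fin N) ℂ) * γ f * (ρR σ⁻¹ : Matrix (Fin N) (Fin N) ℂ))

/-- The coinvariant-cut seam at the level of the rank-2 crux: `FlagGrIsCoinvariant ∧ CoinvariantHosting
→ FlagHosting` is a rewrite of the ideal ((b) fails); the further glue `FlagHosting → crux`
(`ρV :=` permutation matrices, `rename σ =` linear substitution) is routine bookkeeping foreseen in the
route header and is a ONE-piece specialisation ((a) fails). -/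
theorem flagHosting_of_coinvariant (hI : FlagGrIsCoinvariant) (hC : CoinvariantHosting) : FlagHosting := by
  intro ε hε
  obtain ⟨m, N, ρP, ρQ, ρR, α, β, γ, hN, hcard, hkill, hhost, hα, hβ, hγ⟩ := hC ε hε
  refine ⟨m, N, ρP, ρQ, ρR, α, β, γ, hN, hcard, ?_, hhost, hα, hβ, hγ⟩
  intro f hf
  apply hkill
  have h := hI m
  rw [flagGrIdeal] at h
  rw [← h]
  exact hf


/-! ## §T Transfer: the Cohn–Umans criterion transplanted to orbit-harmonics hosts -/

/-- **ABELIAN MONOMIAL CRITERION** (census §T-a; TRUE, provable-now from the `AbelianNoGo`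
vocabulary, M-sized; NOT asserted).  The verbatim transplant of Cohn–Umans' "TPP ⇒ ⟨n,m,p⟩ ≤ ℂ[G]"
(tree: `RealizesTPP.tensorRestrictsTo`) to the orbit-harmonics ring of a free ABELIAN orbit: three
character tables `p, q, r : [N] → Γ^` with the triple-product property for the weights
`p_s⁻¹ q_t`, `q_t⁻¹ r_u`, `p_s⁻¹ r_u` and ADDITIVE LEVELS give an equivariant hosting
(`α E_st := φ_{p_s⁻¹ q_t}`, `β E_tu := φ_{q_t⁻¹ r_u}`, `γ` reads the coefficient of `φ_{p_s⁻¹ r_u}`;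
the normalisation `ev φ_χ = χ` makes all structure constants `1`).  The landed `AbelianNoGo` shows
every hosting it produces has `N³ ≤ |Γ|`: the transplant lands on a dead piece. -/
def AbelianMonomialCriterion : Prop :=
  ∀ (Γ : Type) [CommGroup Γ] [Fintype Γ] (d : ℕ) (ρV : Γ →* GL (Fin d) ℂ) (v : Fin d → ℂ),
    Function.Injective (fun g : Γ => (ρV g : Matrix (Fin d) (Fin d) ℂ).mulVec v) →
    ∀ (N : ℕ) (p q r : Fin N → (Γ →* ℂˣ)),
      (∀ s s' t t' u u' : Fin N,
        (p s)⁻¹ * q t * (q t')⁻¹ * r u = (p s')⁻¹ * r u' → s = s' ∧ t = t' ∧ u = u') →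
      (∀ s t u : Fin N,
        Theorems.AbelianNoGo.lev ρV v ((p s)⁻¹ * q t) + Theorems.AbelianNoGo.lev ρV v ((q t)⁻¹ * r u) =
          Theorems.AbelianNoGo.lev ρV v ((p s)⁻¹ * r u)) →
      ∃ (ρP ρQ ρR : Γ →* GL (Fin N) ℂ) (α β : Matrix (Fin N) (Fin N) ℂ →ₗ[ℂ] MvPolynomial (Fin d) ℂ)
        (γ : MvPolynomial (Fin d) ℂ →ₗ[ℂ] Matrix (Fin N) (Fin N) ℂ), IsHosting Γ d N ρV v ρP ρQ ρR α β γ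

/-- What the transplanted criterion can give toward the crux: nothing below `N³` — any hosting on a
free abelian orbit has `N³ ≤ |Γ|` (the landed `AbelianNoGo_proof`, restated over `IsHosting`). -/
theorem abelian_hosting_cubed_le {Γ : Type} [CommGroup Γ] [Fintype Γ] {d N : ℕ}
    (ρV : Γ →* GL (Fin d) ℂ) (v : Fin d → ℂ) (ρP ρQ ρR : Γ →* GL (Fin N) ℂ)
    (α β : Matrix (Fin N) (Fin N) ℂ →ₗ[ℂ] MvPolynomial (Fin d) ℂ)
    (γ : MvPolynomial (Fin d) ℂ →ₗ[ℂ] Matrix (Fin N) (Fin N) ℂ)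
    (hH : IsHosting Γ d N ρV v ρP ρQ ρR α β γ) : N ^ 3 ≤ Fintype.card Γ := by
  obtain ⟨hinj, hkill, hhost, hα, hβ, hγ⟩ := hH
  exact Theorems.AbelianNoGo_proof Γ d N ρV v ρP ρQ ρR α β γ hinj hkill hhost hα hβ hγ


/-! ## §N′ A second structural constraint (kernel-checked): the Schur channel is closed

In every equivariant hosting the output representations `ρP`, `ρR` are DISJOINT (no common
constituent): invariant output can only be produced by the degree-0 channel of the graded host,
which is rank one, while `(X, Y) ↦ tr(D·X·Y)` has rank `N · rk D`.  Only `γ`-equivariance, the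
hosting identity and "γ kills leading forms" are used (no freeness, no `α`/`β`-equivariance). -/

section Subst

variable {Γ : Type} [Group Γ] {d : ℕ}

/-- The linear substitution `f ↦ f(ρV(g) x)` (the action in the route's equivariance clauses),
for a general (not necessarily abelian) group. -/
noncomputable def sub (ρV : Γ →* GL (Fin d) ℂ) (g : Γ) :
    MvPolynomial (Fin d) ℂ →ₐ[ℂ] MvPolynomial (Fin d) ℂ :=
  MvPolynomial.aeval fun i : Fin d => ∑ j : Fin d,
    (ρV g : Matrix (Fin d) (Fin d) ℂ) i j • (MvPolynomial.X j : MvPolynomial (Fin d) ℂ)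

theorem aeval_sub (ρV : Γ →* GL (Fin d) ℂ) (g : Γ) (x : Fin d → ℂ) (f : MvPolynomial (Fin d) ℂ) :
    MvPolynomial.aeval x (sub ρV g f) =
      MvPolynomial.aeval ((ρV g : Matrix (Fin d) (Fin d) ℂ).mulVec x) f := by
  rw [sub, MvPolynomial.aeval_eq_bind₁, MvPolynomial.aeval_bind₁]
  have hL : (fun i : Fin d => MvPolynomial.aeval x (∑ j : Fin d,
      (ρV g : Matrix (Fin d) (Fin d) ℂ) i j • (MvPolynomial.X j : MvPolynomial (Fin d) ℂ))) =
      (ρV g : Matrix (Fin d) (Fin d) ℂ).mulVec x := by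
    funext i
    simp [Matrix.mulVec, dotProduct]
  rw [hL]

theorem eval_sub (ρV : Γ →* GL (Fin d) ℂ) (g : Γ) (x : Fin d → ℂ) (f : MvPolynomial (Fin d) ℂ) :
    MvPolynomial.eval x (sub ρV g f) =
      MvPolynomial.eval ((ρV g : Matrix (Fin d) (Fin d) ℂ).mulVec x) f :=
  aeval_sub ρV g x f

theorem sub_sub (ρV : Γ →* GL (Fin d) ℂ) (g h : Γ) (f : MvPolynomial (Fin d) ℂ) :
    sub ρV g (sub ρV h f) = sub ρV (h * g) f := by
  apply MvPolynomial.funext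
  intro x
  rw [eval_sub, eval_sub, eval_sub, map_mul, Units.val_mul, Matrix.mulVec_mulVec]

theorem isHomogeneous_sub (ρV : Γ →* GL (Fin d) ℂ) (g : Γ) {f : MvPolynomial (Fin d) ℂ} {n : ℕ}
    (hf : f.IsHomogeneous n) : (sub ρV g f).IsHomogeneous n := by
  have hlin : ∀ i : Fin d, (∑ j : Fin d, (ρV g : Matrix (Fin d) (Fin d) ℂ) i j •
      (MvPolynomial.X j : MvPolynomial (Fin d) ℂ)).IsHomogeneous 1 := by
    intro i
    refine MvPolynomial.IsHomogeneous.sum _ _ _ fun j _ => ?_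
    rw [MvPolynomial.smul_eq_C_mul]
    exact (MvPolynomial.isHomogeneous_X ℂ j).C_mul _
  have h := hf.aeval _ hlin
  rw [one_mul] at h
  exact h

/-- `sub g` commutes with taking homogeneous components. -/
theorem sub_homogeneousComponent (ρV : Γ →* GL (Fin d) ℂ) (g : Γ) (k : ℕ)
    (f : MvPolynomial (Fin d) ℂ) :
    sub ρV g (MvPolynomial.homogeneousComponent k f) =
      MvPolynomial.homogeneousComponent k (sub ρV g f) := by
  classical
  conv_rhs => rw [← MvPolynomial.sum_homogeneousComponent f]
  rw [map_sum, map_sum]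
  have h : ∀ i, MvPolynomial.homogeneousComponent k (sub ρV g (MvPolynomial.homogeneousComponent i f)) =
      if k = i then sub ρV g (MvPolynomial.homogeneousComponent i f) else 0 := fun i =>
    MvPolynomial.homogeneousComponent_of_mem ((MvPolynomial.mem_homogeneousSubmodule i _).2
      (isHomogeneous_sub ρV g (MvPolynomial.homogeneousComponent_isHomogeneous i f)))
  simp only [h, Finset.sum_ite_eq, Finset.mem_range]
  split_ifs with hk
  · rfl
  · have hk' : f.totalDegree < k := by omega
    rw [MvPolynomial.homogeneousComponent_eq_zero k f hk', map_zero]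

end Subst

/-- Leading forms: a nonzero homogeneous `f` of degree `m` minus anything of lower degree has total
degree `m` and top component `f`. -/
theorem leadingForm_of_homogeneous_sub {σ : Type} {f p : MvPolynomial σ ℂ} {m : ℕ}
    (hf : f.IsHomogeneous m) (hf0 : f ≠ 0) (hp : p.totalDegree < m) :
    (f - p).totalDegree = m ∧ MvPolynomial.homogeneousComponent m (f - p) = f := by
  classical
  have hdeg : (f - p).totalDegree = m := by
    apply le_antisymm
    · refine (MvPolynomial.totalDegree_sub f p).trans ?_
      rw [hf.totalDegree hf0]
      exact max_le le_rfl hp.le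
    · obtain ⟨s, hs⟩ := MvPolynomial.exists_coeff_ne_zero hf0
      have hsm : m = ∑ i ∈ s.support, s i :=
        hf.degree_eq_sum_deg_support (MvPolynomial.mem_support_iff.mpr hs)
      have hsp : MvPolynomial.coeff s p = 0 := by
        apply MvPolynomial.coeff_eq_zero_of_totalDegree_lt
        calc p.totalDegree < m := hp
          _ = s.sum fun _ e => e := hsm
      have hmem : s ∈ (f - p).support := by
        rw [MvPolynomial.mem_support_iff, MvPolynomial.coeff_sub, hsp, sub_zero]
        exact hs
      calc m = s.sum (fun _ e => e) := hsm
        _ ≤ (f - p).totalDegree := MvPolynomial.le_totalDegree hmem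
  refine ⟨hdeg, ?_⟩
  rw [map_sub, MvPolynomial.homogeneousComponent_eq_self hf,
    MvPolynomial.homogeneousComponent_eq_zero m p hp, sub_zero]

/-- **Invariant forms of positive degree are leading forms of the orbit ideal.**  A `Γ`-invariant
homogeneous polynomial of degree `m ≥ 1` is constant on the orbit `Γ·v`, so `f - f(v) ∈ I(Γ·v)` with
leading form `f`: hence `f ∈ span LF(I(Γ·v))` (the graded host has its invariants in degree `0`
only — proved upstairs, without the structure theorem for `gr`). -/
theorem mem_spanLF_of_invariant {Γ : Type} [Group Γ] {d : ℕ} (ρV : Γ →* GL (Fin d) ℂ)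
    (v : Fin d → ℂ) {f : MvPolynomial (Fin d) ℂ} {m : ℕ} (hf : f.IsHomogeneous m) (hm : 1 ≤ m)
    (hinv : ∀ g : Γ, sub ρV g f = f) :
    f ∈ Ideal.span ((fun f : MvPolynomial (Fin d) ℂ =>
        MvPolynomial.homogeneousComponent f.totalDegree f) ''
        ((MvPolynomial.vanishingIdeal ℂ (Set.range fun g : Γ =>
          (ρV g : Matrix (Fin d) (Fin d) ℂ).mulVec v) : Ideal (MvPolynomial (Fin d) ℂ)) :
          Set (MvPolynomial (Fin d) ℂ))) := by
  by_cases h0 : f = 0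
  · rw [h0]; exact Submodule.zero_mem _
  apply Ideal.subset_span
  have hlow : (MvPolynomial.C (MvPolynomial.aeval v f) : MvPolynomial (Fin d) ℂ).totalDegree < m := by
    rw [MvPolynomial.totalDegree_C]; exact hm
  obtain ⟨hdeg, htop⟩ := leadingForm_of_homogeneous_sub hf h0 hlow
  refine ⟨f - MvPolynomial.C (MvPolynomial.aeval v f), ?_, ?_⟩
  · rw [SetLike.mem_coe, MvPolynomial.mem_vanishingIdeal_iff]
    rintro x ⟨g, rfl⟩
    dsimp only
    rw [map_sub, ← aeval_sub, hinv g, MvPolynomial.aeval_C]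
    simp
  · dsimp only
    rw [hdeg, htop]

/-- **Schur-channel obstruction** (census §N′, Lean-checked): in a hosting whose `γ` is equivariant
and kills the leading-form ideal of the orbit, every intertwiner `D : ρP → ρR` vanishes (`N ≥ 2`).
So `ρP` and `ρR` share no irreducible constituent; e.g. `(ρP, ρQ, ρR) = (std, ·, std)` is
impossible for `S_m`, and an irreducible design needs `|Γ| ≥ 2N² + 1`. -/
theorem intertwiner_eq_zero_of_hosting {Γ : Type} [Group Γ] [Fintype Γ] {d N : ℕ}
    (ρV : Γ →* GL (Fin d) ℂ) (v : Fin d → ℂ) (ρP ρR : Γ →* GL (Fin N) ℂ)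
    (α β : Matrix (Fin N) (Fin N) ℂ →ₗ[ℂ] MvPolynomial (Fin d) ℂ)
    (γ : MvPolynomial (Fin d) ℂ →ₗ[ℂ] Matrix (Fin N) (Fin N) ℂ)
    (hkill : ∀ f ∈ Ideal.span ((fun f : MvPolynomial (Fin d) ℂ =>
        MvPolynomial.homogeneousComponent f.totalDegree f) ''
        ((MvPolynomial.vanishingIdeal ℂ (Set.range fun g : Γ =>
          (ρV g : Matrix (Fin d) (Fin d) ℂ).mulVec v) : Ideal (MvPolynomial (Fin d) ℂ)) :
          Set (MvPolynomial (Fin d) ℂ))), γ f = 0)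
    (hhost : ∀ X Y, γ (α X * β Y) = X * Y)
    (hγ : ∀ (g : Γ) (f : MvPolynomial (Fin d) ℂ), γ (MvPolynomial.aeval (fun i : Fin d =>
        ∑ j : Fin d, (ρV g : Matrix (Fin d) (Fin d) ℂ) i j •
          (MvPolynomial.X j : MvPolynomial (Fin d) ℂ)) (f)) =
        (ρP g⁻¹ : Matrix (Fin N) (Fin N) ℂ) * γ f * (ρR g : Matrix (Fin N) (Fin N) ℂ))
    (hN : 2 ≤ N) (D : Matrix (Fin N) (Fin N) ℂ)
    (hD : ∀ g : Γ, (ρR g : Matrix (Fin N) (Fin N) ℂ) * D = D * (ρP g : Matrix (Fin N) (Fin N) ℂ)) :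
    D = 0 := by
  -- the invariant functional `Z ↦ tr (D Z)`
  set lam : Matrix (Fin N) (Fin N) ℂ →ₗ[ℂ] ℂ :=
    (Matrix.traceLinearMap (Fin N) ℂ ℂ) ∘ₗ (LinearMap.mulLeft ℂ D) with hlam
  have lam_apply : ∀ Z, lam Z = Matrix.trace (D * Z) := fun Z => rfl
  have hlam_inv : ∀ (g : Γ) (Z : Matrix (Fin N) (Fin N) ℂ),
      lam ((ρP g⁻¹ : Matrix (Fin N) (Fin N) ℂ) * Z * (ρR g : Matrix (Fin N) (Fin N) ℂ)) = lam Z := by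
    intro g Z
    rw [lam_apply, lam_apply, ← Matrix.mul_assoc, ← Matrix.mul_assoc, Matrix.trace_mul_comm,
      ← Matrix.mul_assoc, ← Matrix.mul_assoc, hD g, Matrix.mul_assoc D, ← Units.val_mul,
      map_inv, mul_inv_cancel, Units.val_one, Matrix.mul_one]
  -- `lam ∘ γ` is invariant under the substitution action
  have hμ : ∀ (g : Γ) (f : MvPolynomial (Fin d) ℂ), lam (γ (sub ρV g f)) = lam (γ f) := by
    intro g f
    have := hγ g f
    rw [show MvPolynomial.aeval (fun i : Fin d => ∑ j : Fin d, (ρV g : Matrix (Fin d) (Fin d) ℂ) i j •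
      (MvPolynomial.X j : MvPolynomial (Fin d) ℂ)) f = sub ρV g f from rfl] at this
    rw [this, hlam_inv]
  -- positive-degree homogeneous polynomials are not read by `lam ∘ γ`
  have hvanish : ∀ m : ℕ, 1 ≤ m → ∀ f : MvPolynomial (Fin d) ℂ, f.IsHomogeneous m → lam (γ f) = 0 := by
    intro m hm f hf
    set favg : MvPolynomial (Fin d) ℂ := (Fintype.card Γ : ℂ)⁻¹ • ∑ g : Γ, sub ρV g f with hfavg
    have hcard : (Fintype.card Γ : ℂ) ≠ 0 := by exact_mod_cast Fintype.card_ne_zero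
    -- (1) averaging does not change `lam ∘ γ`
    have h1 : lam (γ favg) = lam (γ f) := by
      rw [hfavg, map_smul, map_smul, map_sum, map_sum]
      simp only [hμ, Finset.sum_const, Finset.card_univ, smul_eq_mul, nsmul_eq_mul]
      field_simp
    -- (2) the average is invariant and homogeneous of degree `m`
    have h2 : ∀ h : Γ, sub ρV h favg = favg := by
      intro h
      rw [hfavg, map_smul, map_sum]
      congr 1
      simp_rw [sub_sub]
      exact Fintype.sum_equiv (Equiv.mulRight h) _ _ fun g => rfl
    have h3 : favg.IsHomogeneous m := by
      rw [hfavg, ← MvPolynomial.C_mul']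
      exact (MvPolynomial.IsHomogeneous.sum _ _ _ fun g _ => isHomogeneous_sub ρV g hf).C_mul _
    -- (3) so it is constant on the orbit, and (being of positive degree) a leading form of `I(P)`
    have h4 : γ favg = 0 := hkill _ (mem_spanLF_of_invariant ρV v h3 hm h2)
    rw [← h1, h4, map_zero]
  -- hence `lam (X Y)` only sees constant terms: a rank-one bilinear form
  have hrank1 : ∀ X Y : Matrix (Fin N) (Fin N) ℂ, lam (X * Y) =
      MvPolynomial.constantCoeff (α X) * MvPolynomial.constantCoeff (β Y) * lam (γ 1) := by
    intro X Y
    rw [← hhost X Y]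
    set f := α X * β Y with hf
    conv_lhs => rw [← MvPolynomial.sum_homogeneousComponent f]
    rw [map_sum, map_sum, Finset.sum_eq_single 0]
    · rw [MvPolynomial.homogeneousComponent_zero, MvPolynomial.C_eq_smul_one, map_smul, map_smul,
        smul_eq_mul, hf, ← MvPolynomial.constantCoeff_eq, map_mul]
    · intro i _ hi0
      exact hvanish i (Nat.one_le_iff_ne_zero.2 hi0) _
        (MvPolynomial.homogeneousComponent_isHomogeneous i f)
    · intro h
      simp at h
  -- evaluate on matrix units: `lam (E_ij E_j'k) = [j = j'] D_ki`
  have trace_mul_single : ∀ i k : Fin N, Matrix.trace (D * Matrix.single i k (1 : ℂ)) = D k i := by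
    intro i k
    simp only [Matrix.trace, Matrix.diag_apply, Matrix.mul_apply, Matrix.single_apply, mul_ite,
      mul_one, mul_zero]
    rw [Finset.sum_eq_single k]
    · rw [Finset.sum_eq_single i]
      · simp
      · intro b _ hb
        rw [if_neg (fun h => hb h.1.symm)]
      · intro h; exact absurd (Finset.mem_univ i) h
    · intro a _ ha
      refine Finset.sum_eq_zero fun b _ => ?_
      rw [if_neg (fun h => ha h.2.symm)]
    · intro h; exact absurd (Finset.mem_univ k) h
  have hunit : ∀ i j j' k : Fin N, lam (Matrix.single i j (1 : ℂ) * Matrix.single j' k (1 : ℂ)) =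
      if j = j' then D k i else 0 := by
    intro i j j' k
    split_ifs with hjj
    · subst hjj
      rw [Matrix.single_mul_single_same, mul_one, lam_apply, trace_mul_single]
    · have h0 : Matrix.single i j (1 : ℂ) * Matrix.single j' k (1 : ℂ) = 0 :=
        Matrix.single_mul_single_of_ne (c := (1 : ℂ)) i j j' hjj (1 : ℂ)
      rw [h0, map_zero]
  set a : Fin N → Fin N → ℂ := fun i j => MvPolynomial.constantCoeff (α (Matrix.single i j (1 : ℂ)))
  set b : Fin N → Fin N → ℂ := fun j k => MvPolynomial.constantCoeff (β (Matrix.single j k (1 : ℂ)))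
  set t : ℂ := lam (γ 1)
  have key : ∀ i j j' k : Fin N, (if j = j' then D k i else 0) = a i j * b j' k * t := by
    intro i j j' k
    rw [← hunit, hrank1]
  ext k i
  by_contra hne
  obtain ⟨j, j', hjj⟩ : ∃ j j' : Fin N, j ≠ j' :=
    ⟨⟨0, by omega⟩, ⟨1, by omega⟩, by simp [Fin.ext_iff]⟩
  have h1 := key i j j k
  have h2 := key i j' j' k
  have h3 := key i j j' k
  rw [if_pos rfl] at h1 h2
  rw [if_neg hjj] at h3
  have ha : a i j ≠ 0 := fun h => hne (by rw [h1, h]; simp)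
  have hb : b j' k ≠ 0 := fun h => hne (by rw [h2, h]; simp)
  have ht : t ≠ 0 := fun h => hne (by rw [h1, h]; simp)
  exact absurd h3.symm (mul_ne_zero (mul_ne_zero ha hb) ht)

/-- Corollary over the route's predicate: no hosting with `ρP = ρR` (the identity intertwines). -/
theorem ne_of_isHosting {Γ : Type} [Group Γ] [Fintype Γ] {d N : ℕ}
    (ρV : Γ →* GL (Fin d) ℂ) (v : Fin d → ℂ) (ρP ρQ ρR : Γ →* GL (Fin N) ℂ)
    (α β : Matrix (Fin N) (Fin N) ℂ →ₗ[ℂ] MvPolynomial (Fin d) ℂ)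
    (γ : MvPolynomial (Fin d) ℂ →ₗ[ℂ] Matrix (Fin N) (Fin N) ℂ) (hN : 2 ≤ N)
    (hH : IsHosting Γ d N ρV v ρP ρQ ρR α β γ) : ρP ≠ ρR := by
  rintro rfl
  obtain ⟨-, hkill, hhost, -, -, hγ⟩ := hH
  have h := intertwiner_eq_zero_of_hosting ρV v ρP ρP α β γ hkill hhost hγ hN 1 (by simp)
  have hN0 : 0 < N := by omega
  have := congrFun (congrFun h ⟨0, hN0⟩) ⟨0, hN0⟩
  simp at this


/-- **Input-side constraint (i)**: an invariant input matrix `C` (an intertwiner `ρQ → ρP`) whose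
image `α C` has no constant term is zero — because the positive-degree invariant components of
`α C` are leading forms of the orbit ideal, so `α C ∈ J` and `C · Y = γ (α C · β Y) = 0`. -/
theorem invariant_eq_zero_of_constantCoeff {Γ : Type} [Group Γ] {d N : ℕ}
    (ρV : Γ →* GL (Fin d) ℂ) (v : Fin d → ℂ) (ρP ρQ : Γ →* GL (Fin N) ℂ)
    (α β : Matrix (Fin N) (Fin N) ℂ →ₗ[ℂ] MvPolynomial (Fin d) ℂ)
    (γ : MvPolynomial (Fin d) ℂ →ₗ[ℂ] Matrix (Fin N) (Fin N) ℂ)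
    (hkill : ∀ f ∈ Ideal.span ((fun f : MvPolynomial (Fin d) ℂ =>
        MvPolynomial.homogeneousComponent f.totalDegree f) ''
        ((MvPolynomial.vanishingIdeal ℂ (Set.range fun g : Γ =>
          (ρV g : Matrix (Fin d) (Fin d) ℂ).mulVec v) : Ideal (MvPolynomial (Fin d) ℂ)) :
          Set (MvPolynomial (Fin d) ℂ))), γ f = 0)
    (hhost : ∀ X Y, γ (α X * β Y) = X * Y)
    (hα : ∀ (g : Γ) (X : Matrix (Fin N) (Fin N) ℂ), α ((ρP g⁻¹ : Matrix (Fin N) (Fin N) ℂ) * X *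
        (ρQ g : Matrix (Fin N) (Fin N) ℂ)) = MvPolynomial.aeval (fun i : Fin d => ∑ j : Fin d,
        (ρV g : Matrix (Fin d) (Fin d) ℂ) i j • (MvPolynomial.X j : MvPolynomial (Fin d) ℂ)) (α X))
    (C : Matrix (Fin N) (Fin N) ℂ)
    (hC : ∀ g : Γ, (ρP g⁻¹ : Matrix (Fin N) (Fin N) ℂ) * C * (ρQ g : Matrix (Fin N) (Fin N) ℂ) = C)
    (h0 : MvPolynomial.constantCoeff (α C) = 0) : C = 0 := by
  classical
  set J := Ideal.span ((fun f : MvPolynomial (Fin d) ℂ =>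
        MvPolynomial.homogeneousComponent f.totalDegree f) ''
        ((MvPolynomial.vanishingIdeal ℂ (Set.range fun g : Γ =>
          (ρV g : Matrix (Fin d) (Fin d) ℂ).mulVec v) : Ideal (MvPolynomial (Fin d) ℂ)) :
          Set (MvPolynomial (Fin d) ℂ))) with hJ
  -- `α C` is invariant upstairs
  have hinv : ∀ g : Γ, sub ρV g (α C) = α C := by
    intro g
    have := hα g C
    rw [hC g] at this
    exact this.symm
  -- every homogeneous component of `α C` lies in `J` (degree 0: it vanishes)
  have hcomp : ∀ i : ℕ, MvPolynomial.homogeneousComponent i (α C) ∈ J := by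
    intro i
    rcases Nat.eq_zero_or_pos i with rfl | hi
    · rw [MvPolynomial.homogeneousComponent_zero, ← MvPolynomial.constantCoeff_eq]
      rw [h0, MvPolynomial.C_0]
      exact Submodule.zero_mem _
    · exact mem_spanLF_of_invariant ρV v (MvPolynomial.homogeneousComponent_isHomogeneous i _) hi
        fun g => by rw [sub_homogeneousComponent, hinv g]
  have hmem : α C ∈ J := by
    rw [← MvPolynomial.sum_homogeneousComponent (α C)]
    exact Submodule.sum_mem _ fun i _ => hcomp i
  have hzero : ∀ Y, C * Y = 0 := by
    intro Y
    rw [← hhost C Y]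
    exact hkill _ (Ideal.mul_mem_right _ _ hmem)
  simpa using hzero 1

/-- **Input-side constraint (ii)**: any two intertwiners `ρQ → ρP` are proportional
(`dim Hom_Γ(ρQ, ρP) ≤ 1`; symmetrically for `β` and `Hom_Γ(ρR, ρQ)`). -/
theorem invariants_proportional {Γ : Type} [Group Γ] {d N : ℕ}
    (ρV : Γ →* GL (Fin d) ℂ) (v : Fin d → ℂ) (ρP ρQ : Γ →* GL (Fin N) ℂ)
    (α β : Matrix (Fin N) (Fin N) ℂ →ₗ[ℂ] MvPolynomial (Fin d) ℂ)
    (γ : MvPolynomial (Fin d) ℂ →ₗ[ℂ] Matrix (Fin N) (Fin N) ℂ)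
    (hkill : ∀ f ∈ Ideal.span ((fun f : MvPolynomial (Fin d) ℂ =>
        MvPolynomial.homogeneousComponent f.totalDegree f) ''
        ((MvPolynomial.vanishingIdeal ℂ (Set.range fun g : Γ =>
          (ρV g : Matrix (Fin d) (Fin d) ℂ).mulVec v) : Ideal (MvPolynomial (Fin d) ℂ)) :
          Set (MvPolynomial (Fin d) ℂ))), γ f = 0)
    (hhost : ∀ X Y, γ (α X * β Y) = X * Y)
    (hα : ∀ (g : Γ) (X : Matrix (Fin N) (Fin N) ℂ), α ((ρP g⁻¹ : Matrix (Fin N) (Fin N) ℂ) * X *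
        (ρQ g : Matrix (Fin N) (Fin N) ℂ)) = MvPolynomial.aeval (fun i : Fin d => ∑ j : Fin d,
        (ρV g : Matrix (Fin d) (Fin d) ℂ) i j • (MvPolynomial.X j : MvPolynomial (Fin d) ℂ)) (α X))
    (C C' : Matrix (Fin N) (Fin N) ℂ)
    (hC : ∀ g : Γ, (ρP g⁻¹ : Matrix (Fin N) (Fin N) ℂ) * C * (ρQ g : Matrix (Fin N) (Fin N) ℂ) = C)
    (hC' : ∀ g : Γ, (ρP g⁻¹ : Matrix (Fin N) (Fin N) ℂ) * C' * (ρQ g : Matrix (Fin N) (Fin N) ℂ) = C') :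
    MvPolynomial.constantCoeff (α C') • C = MvPolynomial.constantCoeff (α C) • C' := by
  set a := MvPolynomial.constantCoeff (α C)
  set a' := MvPolynomial.constantCoeff (α C')
  have hinv : ∀ g : Γ, (ρP g⁻¹ : Matrix (Fin N) (Fin N) ℂ) * (a' • C - a • C') *
      (ρQ g : Matrix (Fin N) (Fin N) ℂ) = a' • C - a • C' := by
    intro g
    rw [Matrix.mul_sub, Matrix.sub_mul, Matrix.mul_smul, Matrix.smul_mul, Matrix.mul_smul,
      Matrix.smul_mul, hC g, hC' g]
  have h0 : MvPolynomial.constantCoeff (α (a' • C - a • C')) = 0 := by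
    rw [map_sub, map_smul, map_smul, map_sub, MvPolynomial.constantCoeff_smul,
      MvPolynomial.constantCoeff_smul]
    simp only [smul_eq_mul, a, a']
    ring
  have := invariant_eq_zero_of_constantCoeff ρV v ρP ρQ α β γ hkill hhost hα _ hinv h0
  exact sub_eq_zero.1 this

end Summit.MatrixMultiplication.MatrixMultiplication.Cruxes.EquivariantOrbitHosting.Strategist
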